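import Summits.CriticalPhenomena.PercolationContinuityZ3.Theorems.PercNearOneGluingNoHeavyLowerTailPocketCSHPreMargin
import HarnessLib

/-!
# Kozma–Nitzan's Question 8 for EVERY relay set, conditional on the pocket conditioned slack hierarchy (assembly)

Support file (`--supports stmt-CriticalPhenomena-4575`, closed crux; independent mathematics), prover `prim-ineq-gen-7` (gen 10).
Memo `run/shared/lean/prim/prim-ineq-gen-7/FINDING-Q8-POCKET-g10.md` §3.  No definitions, no named facts, no sorries; standard axioms.

From `PocketCSH.preMargin_nonneg_of_pcsh` (`…PocketCSHPreMargin.lean`) at `D = []` with a second observer `v` that cannot reach `o`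
(`μ(v ↔ o) = 0`, e.g. a spare isolated vertex; then the observers' constant `p` vanishes):
* `PocketCSH.pocketDesignee_of_pcsh` — `∫_{o↔X} F(C c) ≤ ∫_{o↔X} F(C o)` for the pocket designee `c` (`∫_P F(C c) ≤ ∫_P F(C a)`, `a ∈ X`),
  every `|X|`, every monotone `F` (Kozma–Nitzan's Conjecture-4 shape);
* `PocketCSH.block41_of_pcsh` — `F = 1{b ∈ ·}`: (41) `μ({c↔b} ∩ {o↔X}) ≤ μ({o↔b} ∩ {o↔X})` for the minimiser of `μ({a↔b} ∩ P)`; with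
  `𝒟 = {S | S ∩ X = ∅}` (`P = {o ↮ X}`) this is KN QUESTION 8 (arXiv:2401.12397 §5.5 p. 36) for every `|X|`, conditional on `PCSHHolds`.
[cite: KozmaNitzan2024, Question 8 (§5.5 p. 36), Conj. 4 (p. 32)] [cite: VandenbergHaggstromKahn2005, Thm. 1.3 (p. 6)]
-/

noncomputable section

namespace Summit.CriticalPhenomena.PercolationContinuityZ3.Theorems

open MeasureTheory Set Literature.Probability.LatticeModels Literature.Probability.Percolation
open scoped Classical
open KNPreFKG CSH PreFKGSurplus

namespace PocketCSH

variable {n : ℕ}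

/-- **(41) for the pocket designee, every relay set, from PCSH** (Conjecture-4 shape).  Weights `< 1`, `{o} ∈ 𝒟`, a second observer `v`
with `μ(v ↔ o) = 0` (e.g. a spare isolated vertex) and the pocket hierarchy for every owner / avoided set / decoy list; then for every
`X ∌ o, v`, every monotone `F` and every `c ∈ X` minimising `a ↦ ∫_P F(C a)`:  `∫_{o↔X} F(C c) ≤ ∫_{o↔X} F(C o)`.
[cite: KozmaNitzan2024, Question 8 (§5.5 p. 36), Conj. 4 (p. 32)] -/
theorem pocketDesignee_of_pcsh (w : Sym2 (Fin n) → unitInterval) (hw : ∀ e, w e < 1) (o v : Fin n)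
    (hvo : (prodBernoulli w).real (openConn v o) = 0)
    (𝒟 : Set (Set (Fin n))) (h𝒟o : ({o} : Set (Fin n)) ∈ 𝒟)
    (hPCSH : ∀ (x : Fin n) (Y : Finset (Fin n)) (D : List (Fin n)),
      x ∉ Y → o ≠ x → v ≠ x → o ∉ Y → v ∉ Y → D.Nodup → (∀ d ∈ D, d ≠ x ∧ d ∉ Y ∧ d ≠ o ∧ d ≠ v) →
      PCSHHolds w o 𝒟 x (↑Y : Set (Fin n)) D v)
    (X : Finset (Fin n)) (c : Fin n) (F : Set (Fin n) → ℝ) (hF : ∀ S S' : Set (Fin n), S ⊆ S' → F S ≤ F S') (hcX : c ∈ X)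
    (hcmin : ∀ a ∈ X, ∫ ω in pocketEv o 𝒟, F (openCluster ω c) ∂(prodBernoulli w) ≤ ∫ ω in pocketEv o 𝒟, F (openCluster ω a) ∂(prodBernoulli w))
    (hoX : o ∉ X) (hvX : v ∉ X) :
    ∫ ω in ⋃ a ∈ X, openConn o a, F (openCluster ω c) ∂(prodBernoulli w) ≤
      ∫ ω in ⋃ a ∈ X, openConn o a, F (openCluster ω o) ∂(prodBernoulli w) := by
  classical
  have hint : ∀ (g : BondConfig (Fin n) → ℝ), Integrable g (prodBernoulli w) := fun g => Integrable.of_finite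
  have h := preMargin_nonneg_of_pcsh w hw o v 𝒟 h𝒟o hPCSH X c [] F hF hcX hcmin hoX hvX List.nodup_nil (fun d hd => by simp at hd)
  -- the observers' constant vanishes: `μ({v ↮ X} ∩ {v↔o}) ≤ μ(v↔o) = 0`
  have hp0 : pObsConst w o 𝒟 v ((↑X : Set (Fin n)) ∪ {d | d ∈ ([] : List (Fin n))}) = 0 := by
    unfold pObsConst
    have hle : (prodBernoulli w).real ({ω : BondConfig (Fin n) | ∀ a ∈ (↑X : Set (Fin n)) ∪ {d | d ∈ ([] : List (Fin n))},
        ¬ (openGraph ω).Reachable v a} ∩ openConn v o) ≤ 0 := by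
      rw [← hvo]; exact measureReal_mono (h₂ := measure_ne_top _ _) inter_subset_right
    rw [le_antisymm hle measureReal_nonneg, zero_div]
  rw [pDecoyList_nil, hp0, cshMarg_nil, zero_mul, sub_zero] at h
  simp only [if_true] at h
  rw [integral_sub (hint _).integrableOn (hint _).integrableOn] at h
  linarith

/-- **KN QUESTION 8 — and (41) for every pocket designation — for EVERY relay set, conditional on the pocket hierarchy.**
Weights `< 1`, `{o} ∈ 𝒟`, a second observer `v` with `μ(v↔o) = 0`, and `PCSHHolds` for all data; then for every `X ∌ o, v`, every target `b`
and every `c ∈ X` minimising `a ↦ μ({a↔b} ∩ P)` (`P = {C_o ∈ 𝒟}`; `𝒟 = {S | S ∩ X = ∅}` is Question 8's score `μ(a↔b, o↮X)`):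
`μ({c↔b} ∩ {o↔X}) ≤ μ({o↔b} ∩ {o↔X})`. [cite: KozmaNitzan2024, Question 8 (§5.5 p. 36)] -/
theorem block41_of_pcsh (w : Sym2 (Fin n) → unitInterval) (hw : ∀ e, w e < 1) (o v : Fin n)
    (hvo : (prodBernoulli w).real (openConn v o) = 0)
    (𝒟 : Set (Set (Fin n))) (h𝒟o : ({o} : Set (Fin n)) ∈ 𝒟)
    (hPCSH : ∀ (x : Fin n) (Y : Finset (Fin n)) (D : List (Fin n)),
      x ∉ Y → o ≠ x → v ≠ x → o ∉ Y → v ∉ Y → D.Nodup → (∀ d ∈ D, d ≠ x ∧ d ∉ Y ∧ d ≠ o ∧ d ≠ v) →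
      PCSHHolds w o 𝒟 x (↑Y : Set (Fin n)) D v)
    (X : Finset (Fin n)) (c b : Fin n) (hcX : c ∈ X)
    (hcmin : ∀ a ∈ X, (prodBernoulli w).real (openConn c b ∩ pocketEv o 𝒟) ≤ (prodBernoulli w).real (openConn a b ∩ pocketEv o 𝒟))
    (hoX : o ∉ X) (hvX : v ∉ X) :
    (prodBernoulli w).real (openConn c b ∩ ⋃ a ∈ X, openConn o a) ≤ (prodBernoulli w).real (openConn o b ∩ ⋃ a ∈ X, openConn o a) := by
  classical
  have hmeas : ∀ S : Set (BondConfig (Fin n)), MeasurableSet S := fun _ => MeasurableSet.of_discrete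
  set F : Set (Fin n) → ℝ := fun S => if b ∈ S then 1 else 0 with hFdef
  have hF : ∀ S S' : Set (Fin n), S ⊆ S' → F S ≤ F S' := by
    intro S S' hSS'
    simp only [hFdef]
    by_cases hb : b ∈ S
    · rw [if_pos hb, if_pos (hSS' hb)]
    · rw [if_neg hb]; split_ifs <;> norm_num
  -- `∫_E F(C u) = μ({u↔b} ∩ E)`
  have hind : ∀ (u : Fin n) (E : Set (BondConfig (Fin n))),
      ∫ ω in E, F (openCluster ω u) ∂(prodBernoulli w) = (prodBernoulli w).real (openConn u b ∩ E) := by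
    intro u E
    have hfe : (fun ω : BondConfig (Fin n) => F (openCluster ω u)) = (openConn u b : Set (BondConfig (Fin n))).indicator 1 := by
      funext ω
      by_cases hb : (openGraph ω).Reachable u b
      · have h1 : ω ∈ (openConn u b : Set (BondConfig (Fin n))) := hb
        have h2 : b ∈ openCluster ω u := hb
        rw [indicator_of_mem h1, Pi.one_apply]
        simp only [hFdef, if_pos h2]
      · have h1 : ω ∉ (openConn u b : Set (BondConfig (Fin n))) := hb
        have h2 : b ∉ openCluster ω u := hb
        rw [indicator_of_notMem h1]
        simp only [hFdef, if_neg h2]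
    rw [hfe, integral_indicator_one (hmeas _), measureReal_restrict_apply (hmeas _)]
  have key := pocketDesignee_of_pcsh w hw o v hvo 𝒟 h𝒟o hPCSH X c F hF hcX
    (fun a ha => by rw [hind, hind]; exact hcmin a ha) hoX hvX
  rwa [hind, hind] at key

end PocketCSH

end Summit.CriticalPhenomena.PercolationContinuityZ3.Theorems

end
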